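import Summits.AtomisticToContinuum.Crystallization.Theorems.FrustratedLawDichotomySignedLedgerKernel

/-!
# FrustratedLawDichotomy · crux `AperiodicFrustratedLawGap` (stmt-AtomisticToContinuum-27623) — the TWO-CLASS / GRADED / CLASS ledgers in KERNEL currency
# (decomp-a2c hand-2 g45, STRUCTURAL share #59: DEF-FREE companion of `…SignedLedgerKernel` (#50) × `…SignedLedgerErgodic` §1 (#49))

The defect-density piece of the E′ door (`hdef` of `…SignedLedgerTextureDoor` / `…SignedLedgerTwoRegimeDoor`) will be a ledger with a GOOD set
(coherent / chartable roots, host-gap credit `γ`, charge `q`) and BAD roots carrying the H-side credit — constant `σ`, or `σ (m μ)` GRADED by a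
finite measurable index (the «ONE H-side table σ_H(m)», critic r1685/r1688) —, its floors written in REAL numbers with the first-variation transport as
a real signed kernel `s` (the contract of `…SignedLedgerKernel`).  This file is that combination by name, with NO new definitions:

* ★ `nonempty_lawLedger_of_signedKernel_twoClass` — good/bad with constant credits `γ`, `σ`, charges `q`, `r`, floors
  `c + γ − q μ ≤ rootEnergy μ + (∫ s_in − ∫ s_out)` on good, `c + σ − r μ ≤ …` on bad, coercivity `∫_good q + ∫_bad r < γ·P(good) + σ·P(bad)`;
* ★ `nonempty_lawLedger_of_signedKernel_gradedCredit` — the same with `σ (m μ)` graded, coercivity against `Σ_k σ_k · P(m = k ∧ bad)`;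
* `nonempty_lawLedger_of_signedKernel_classFloors` — `n` classes, credit `γ_k` and charge `q_k` per class;
* the corresponding `lt_integral_rootEnergy_…` corollaries under point-stationarity.

Kernel hypotheses as in #50: `s` jointly measurable, `|s μ y| ≤ M` and `s μ y = 0` for `‖y‖ > r` on rooted `δ`-hard-core configurations.  Tags: [folklore: bookkeeping].
-/

noncomputable section

namespace Summit.AtomisticToContinuum.Crystallization.Theorems.FrustratedLawDichotomySignedLedgerKernelGraded

open MeasureTheory Metric Set Filter
open scoped ENNReal Topology BigOperators
open Literature.MathematicalPhysics.StatisticalMechanics Literature.Probability.Process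
open Summit.AtomisticToContinuum.Crystallization.Theorems.ChargedEnergyGapNegative (E3 eStar)
open Summit.AtomisticToContinuum.Crystallization.Theorems.FrustratedLawDichotomySignedLedger (LawLedger net)
open Summit.AtomisticToContinuum.Crystallization.Theorems.FrustratedLawDichotomySignedLedgerErgodic
  (nonempty_lawLedger_of_gradedBadCredit nonempty_lawLedger_of_classFloors)
open Summit.AtomisticToContinuum.Crystallization.Theorems.FrustratedLawDichotomySignedLedgerKernel
  (measurable_posPart measurable_negPart outflow_parts_ne_top net_parts_eq)

variable {δ : ℝ} {P : Measure (Measure E3)} {s : Measure E3 → E3 → ℝ} {M r : ℝ}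

/-- ★ **TWO-CLASS LEDGER IN KERNEL CURRENCY** (constant credits).  [folklore: bookkeeping] -/
theorem nonempty_lawLedger_of_signedKernel_twoClass (hδ : 0 < δ) [IsProbabilityMeasure P] (hcore : ∀ᵐ μ ∂P, IsRootedHardCore δ μ)
    (hs : Measurable (Function.uncurry s)) (hM : ∀ μ : Measure E3, IsRootedHardCore δ μ → ∀ y, |s μ y| ≤ M)
    (hr : ∀ μ : Measure E3, IsRootedHardCore δ μ → ∀ y : E3, r < ‖y‖ → s μ y = 0) {c : ℝ}
    (good : Set (Measure E3)) (hgood : MeasurableSet good) (γ σ : ℝ) (q ρ : Measure E3 → ℝ) (hq : Integrable q P) (hρ : Integrable ρ P)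
    (hfloor_good : ∀ᵐ μ ∂P, μ ∈ good →
      c + γ - q μ ≤ rootEnergy lennardJones μ + ((∫ y, s (μ.map fun z => z - y) (-y) ∂μ) - ∫ y, s μ y ∂μ))
    (hfloor_bad : ∀ᵐ μ ∂P, μ ∉ good →
      c + σ - ρ μ ≤ rootEnergy lennardJones μ + ((∫ y, s (μ.map fun z => z - y) (-y) ∂μ) - ∫ y, s μ y ∂μ))
    (hco : (∫ μ in good, q μ ∂P) + (∫ μ in goodᶜ, ρ μ ∂P) < γ * P.real good + σ * P.real goodᶜ) :
    Nonempty (LawLedger P c) := by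
  obtain ⟨houtF, houtG⟩ := outflow_parts_ne_top hδ hcore hM hr
  exact ⟨{ F := fun μ y => ENNReal.ofReal (s μ y)
           G := fun μ y => ENNReal.ofReal (-s μ y)
           measF := measurable_posPart hs
           measG := measurable_negPart hs
           outF_ne_top := houtF
           outG_ne_top := houtG
           good := good
           good_meas := hgood
           γ := γ
           σ := σ
           q := q
           r := ρ
           q_int := hq
           r_int := hρ
           floor_good := by
             filter_upwards [hcore, hfloor_good] with μ hμ h hg
             rw [net_parts_eq hδ hμ hs hM hr]
             exact h hg
           floor_bad := by
             filter_upwards [hcore, hfloor_bad] with μ hμ h hb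
             rw [net_parts_eq hδ hμ hs hM hr]
             exact h hb
           coercive := hco }⟩

/-- The two-class kernel ledger prices the mean. [folklore: bookkeeping] -/
theorem lt_integral_rootEnergy_of_signedKernel_twoClass (hδ : 0 < δ) [IsProbabilityMeasure P]
    (hcore : ∀ᵐ μ ∂P, IsRootedHardCore δ μ) (hstat : IsPointStationaryLaw P)
    (hs : Measurable (Function.uncurry s)) (hM : ∀ μ : Measure E3, IsRootedHardCore δ μ → ∀ y, |s μ y| ≤ M)
    (hr : ∀ μ : Measure E3, IsRootedHardCore δ μ → ∀ y : E3, r < ‖y‖ → s μ y = 0) {c : ℝ}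
    (good : Set (Measure E3)) (hgood : MeasurableSet good) (γ σ : ℝ) (q ρ : Measure E3 → ℝ) (hq : Integrable q P) (hρ : Integrable ρ P)
    (hfloor_good : ∀ᵐ μ ∂P, μ ∈ good →
      c + γ - q μ ≤ rootEnergy lennardJones μ + ((∫ y, s (μ.map fun z => z - y) (-y) ∂μ) - ∫ y, s μ y ∂μ))
    (hfloor_bad : ∀ᵐ μ ∂P, μ ∉ good →
      c + σ - ρ μ ≤ rootEnergy lennardJones μ + ((∫ y, s (μ.map fun z => z - y) (-y) ∂μ) - ∫ y, s μ y ∂μ))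
    (hco : (∫ μ in good, q μ ∂P) + (∫ μ in goodᶜ, ρ μ ∂P) < γ * P.real good + σ * P.real goodᶜ) :
    c < ∫ μ, rootEnergy lennardJones μ ∂P := by
  obtain ⟨L⟩ := nonempty_lawLedger_of_signedKernel_twoClass hδ hcore hs hM hr good hgood γ σ q ρ hq hρ hfloor_good hfloor_bad hco
  exact L.lt_integral_rootEnergy hδ hcore hstat

/-- ★ **GRADED-CREDIT LEDGER IN KERNEL CURRENCY**: bad-root credit `σ (m μ)` graded by a finite measurable index `m` (the «ONE H-side table
σ_H(m)» shape). [folklore: bookkeeping] -/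
theorem nonempty_lawLedger_of_signedKernel_gradedCredit (hδ : 0 < δ) [IsProbabilityMeasure P] (hcore : ∀ᵐ μ ∂P, IsRootedHardCore δ μ)
    (hs : Measurable (Function.uncurry s)) (hM : ∀ μ : Measure E3, IsRootedHardCore δ μ → ∀ y, |s μ y| ≤ M)
    (hr : ∀ μ : Measure E3, IsRootedHardCore δ μ → ∀ y : E3, r < ‖y‖ → s μ y = 0) {c : ℝ} {n : ℕ}
    (good : Set (Measure E3)) (hgood : MeasurableSet good) (m : Measure E3 → Fin n) (hm : ∀ k, MeasurableSet (m ⁻¹' {k}))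
    (γ : ℝ) (σ : Fin n → ℝ) (q ρ : Measure E3 → ℝ) (hq : Integrable q P) (hρ : Integrable ρ P)
    (hfloor_good : ∀ᵐ μ ∂P, μ ∈ good →
      c + γ - q μ ≤ rootEnergy lennardJones μ + ((∫ y, s (μ.map fun z => z - y) (-y) ∂μ) - ∫ y, s μ y ∂μ))
    (hfloor_bad : ∀ᵐ μ ∂P, μ ∉ good →
      c + σ (m μ) - ρ μ ≤ rootEnergy lennardJones μ + ((∫ y, s (μ.map fun z => z - y) (-y) ∂μ) - ∫ y, s μ y ∂μ))
    (hco : (∫ μ in good, q μ ∂P) + (∫ μ in goodᶜ, ρ μ ∂P) < γ * P.real good + ∑ k, σ k * P.real (m ⁻¹' {k} ∩ goodᶜ)) :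
    Nonempty (LawLedger P c) := by
  obtain ⟨houtF, houtG⟩ := outflow_parts_ne_top hδ hcore hM hr
  refine nonempty_lawLedger_of_gradedBadCredit good hgood m hm γ σ q ρ hq hρ (measurable_posPart hs) (measurable_negPart hs)
    houtF houtG ?_ ?_ hco
  · filter_upwards [hcore, hfloor_good] with μ hμ h hg
    rw [net_parts_eq hδ hμ hs hM hr]
    exact h hg
  · filter_upwards [hcore, hfloor_bad] with μ hμ h hb
    rw [net_parts_eq hδ hμ hs hM hr]
    exact h hb

/-- The graded kernel ledger prices the mean. [folklore: bookkeeping] -/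
theorem lt_integral_rootEnergy_of_signedKernel_gradedCredit (hδ : 0 < δ) [IsProbabilityMeasure P]
    (hcore : ∀ᵐ μ ∂P, IsRootedHardCore δ μ) (hstat : IsPointStationaryLaw P)
    (hs : Measurable (Function.uncurry s)) (hM : ∀ μ : Measure E3, IsRootedHardCore δ μ → ∀ y, |s μ y| ≤ M)
    (hr : ∀ μ : Measure E3, IsRootedHardCore δ μ → ∀ y : E3, r < ‖y‖ → s μ y = 0) {c : ℝ} {n : ℕ}
    (good : Set (Measure E3)) (hgood : MeasurableSet good) (m : Measure E3 → Fin n) (hm : ∀ k, MeasurableSet (m ⁻¹' {k}))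
    (γ : ℝ) (σ : Fin n → ℝ) (q ρ : Measure E3 → ℝ) (hq : Integrable q P) (hρ : Integrable ρ P)
    (hfloor_good : ∀ᵐ μ ∂P, μ ∈ good →
      c + γ - q μ ≤ rootEnergy lennardJones μ + ((∫ y, s (μ.map fun z => z - y) (-y) ∂μ) - ∫ y, s μ y ∂μ))
    (hfloor_bad : ∀ᵐ μ ∂P, μ ∉ good →
      c + σ (m μ) - ρ μ ≤ rootEnergy lennardJones μ + ((∫ y, s (μ.map fun z => z - y) (-y) ∂μ) - ∫ y, s μ y ∂μ))
    (hco : (∫ μ in good, q μ ∂P) + (∫ μ in goodᶜ, ρ μ ∂P) < γ * P.real good + ∑ k, σ k * P.real (m ⁻¹' {k} ∩ goodᶜ)) :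
    c < ∫ μ, rootEnergy lennardJones μ ∂P := by
  obtain ⟨L⟩ := nonempty_lawLedger_of_signedKernel_gradedCredit hδ hcore hs hM hr good hgood m hm γ σ q ρ hq hρ
    hfloor_good hfloor_bad hco
  exact L.lt_integral_rootEnergy hδ hcore hstat

/-- **CLASS LEDGER IN KERNEL CURRENCY**: `n` classes, credit `γ_k`, charge `q_k`. [folklore: bookkeeping] -/
theorem nonempty_lawLedger_of_signedKernel_classFloors (hδ : 0 < δ) [IsProbabilityMeasure P] (hcore : ∀ᵐ μ ∂P, IsRootedHardCore δ μ)
    (hs : Measurable (Function.uncurry s)) (hM : ∀ μ : Measure E3, IsRootedHardCore δ μ → ∀ y, |s μ y| ≤ M)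
    (hr : ∀ μ : Measure E3, IsRootedHardCore δ μ → ∀ y : E3, r < ‖y‖ → s μ y = 0) {c : ℝ} {n : ℕ}
    (cls : Measure E3 → Fin n) (hcls : ∀ k, MeasurableSet (cls ⁻¹' {k})) (γ : Fin n → ℝ) (q : Fin n → Measure E3 → ℝ)
    (hq : ∀ k, Integrable (q k) P)
    (hfloor : ∀ᵐ μ ∂P, c + (γ (cls μ) - q (cls μ) μ) ≤
      rootEnergy lennardJones μ + ((∫ y, s (μ.map fun z => z - y) (-y) ∂μ) - ∫ y, s μ y ∂μ))
    (hco : ∑ k, ∫ μ in cls ⁻¹' {k}, q k μ ∂P < ∑ k, γ k * P.real (cls ⁻¹' {k})) : Nonempty (LawLedger P c) := by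
  obtain ⟨houtF, houtG⟩ := outflow_parts_ne_top hδ hcore hM hr
  refine nonempty_lawLedger_of_classFloors cls hcls γ q hq (measurable_posPart hs) (measurable_negPart hs) houtF houtG ?_ hco
  filter_upwards [hcore, hfloor] with μ hμ h
  rw [net_parts_eq hδ hμ hs hM hr]
  exact h

end Summit.AtomisticToContinuum.Crystallization.Theorems.FrustratedLawDichotomySignedLedgerKernelGraded

end
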